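import Summits.Ventures.LatticeQCDFlow.TrivializingMaps.FisherZerosExtensive
import Summits.Ventures.LatticeQCDFlow.TrivializingMaps.FisherZeroRadiusSharp

/-!
HONEST FRAMING: exact (Metropolis-corrected) sampling algorithms for lattice gauge theory; figures
of merit are autocorrelation/cost numbers at stated couplings and volumes; no continuum-physics
claim.

# WilsonFisherZerosExtensive — THE FISHER ZEROS OF THE FINITE-VOLUME WILSON PARTITION FUNCTION IN A
# FIXED DISC ARE EXTENSIVE: total multiplicity in `|s| < R` at least `ρ²·(m₂(n) − 4n/R)·#plaquettes`
# (lean-2 GEN-7, ours)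

Venture-side (OURS).  Cell `lqcd-flow` (pub-lqcd), unit `pub-lqcd-lean-2-g7`, 2026-08-22.

`FisherZerosExtensive.exists_zeros_sum_divisor_ge_centred` for the observable `-S_W∘ι` under
`D[U]` (centre and half-range `n·#plaq`, `Var_{D[U]}(S_W) = m₂(n)·#plaq` — `WilsonVarianceExtensive`)
with the volume-uniform zero-free radius `ρ = ρ(d, n, B) > 0` of THEOREM A + COROLLARY F′
(`wilson_actionZ_zeroFree_uniform`):

* **`wilson_fisherZeros_extensive`** — for `n ≥ 2` (any `d`; for `d ≤ 1` there are no plaquettes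
  and the bound is trivial) and a basis `B` of `𝔰𝔲(n)` there is `ρ > 0` such that for EVERY `L ≥ 2`
  and every `R > 0` the Wilson partition function
  `Z_L(s) = ∫ D[U] e^{-sS_W}` has a finite set of zeros `u` with `ρ ≤ |u| < R` whose multiplicities sum
  to at least `ρ²·(m₂(n) − 4n/R)·#plaquettes(d, L)`;
* `wilson_su2_fisherZeros_extensive` — `SU(2)` (`m₂ = 1`): at least `ρ²·(1 − 8/R)·#plaq` zeros
  (with multiplicity) in `|s| < R`; e.g. `≥ ρ²·#plaq/2` in `|s| < 16`;
* `wilson_sun_fisherZeros_extensive` — `SU(n)`, `n ≥ 3` (`m₂ = ½`): at least `ρ²·(½ − 4n/R)·#plaq`;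
* **EXPLICIT radius**: `wilson_actionZ_zeroFree_theta1` — `Z_L(s) ≠ 0` for `|s| < 1/θ₁(d, n, B)` in EVERY
  volume (`θ₁ = GradedSeries.theta1`, the growth constant of the tree's proved THEOREM A), hence
  `wilson_fisherZeros_extensive_explicit`: at least `θ₁⁻²·(m₂(n) − 4n/R)·#plaq` zeros with
  `1/θ₁ ≤ |u| < R`, every `L ≥ 2` (`wilson_fisherZeros_extensive_of_zeroFree` for any zero-free radius).

So the obstruction met by the coupling-continuation staircase (THEOREM S, several-zeros form) is not
one zero but a number of zeros proportional to the volume inside a disc of fixed radius.  NOT CLAIMED: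
the size of `θ₁` (an explicit but unevaluated constant of `d`, `n`, `B`); any count for a
concrete volume; the location of the zeros beyond `ρ ≤ |u| < R`; cost / autocorrelation / continuum.
-/

noncomputable section

open MeasureTheory ProbabilityTheory Complex Metric Set Filter Topology MeromorphicOn
open Literature.MathematicalPhysics.QuantumFieldTheory
open Literature.MathematicalPhysics.QuantumFieldTheory.Luscher2010
open Literature.MathematicalPhysics.QuantumFieldTheory.WilsonFlow (coeConfig continuous_coeConfig)
open scoped Matrix Matrix.Norms.Frobenius ContDiff

namespace Summit.Ventures.LatticeQCDFlow.TrivializingMaps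

variable {d n : ℕ}

/-- The extensive-zeros bound from ANY volume-uniform zero-free radius `ρ` (helper). [ours] -/
theorem wilson_fisherZeros_extensive_of_zeroFree (hn : 2 ≤ n) {ρ : ℝ} (hρ : 0 < ρ) (L : ℕ) [NeZero L]
    (hL : 2 ≤ L)
    (hfree : ∀ s : ℂ, ‖s‖ < ρ → complexMGF (fun U => -ambWilsonAction (coeConfig U))
      (trivialMeasure (Matrix.specialUnitaryGroup (Fin n) ℂ) d L) s ≠ 0) (R : ℝ) (hR : 0 < R) :
    ∃ T : Finset ℂ, (∀ u ∈ T,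
        complexMGF (fun U => -ambWilsonAction (coeConfig U))
            (trivialMeasure (Matrix.specialUnitaryGroup (Fin n) ℂ) d L) u = 0 ∧
          ρ ≤ ‖u‖ ∧ ‖u‖ < R ∧
          1 ≤ divisor (complexMGF (fun U => -ambWilsonAction (coeConfig U))
            (trivialMeasure (Matrix.specialUnitaryGroup (Fin n) ℂ) d L)) (closedBall (0 : ℂ) (2 * R)) u) ∧
      ρ ^ 2 * ((∫ g, ((g : Matrix (Fin n) (Fin n) ℂ)).trace.re ^ 2
          ∂(haarProbability (Matrix.specialUnitaryGroup (Fin n) ℂ))) - 4 * n / R) *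
          Fintype.card (Plaquette d L) ≤
        ∑ u ∈ T, (divisor (complexMGF (fun U => -ambWilsonAction (coeConfig U))
            (trivialMeasure (Matrix.specialUnitaryGroup (Fin n) ℂ) d L)) (closedBall (0 : ℂ) (2 * R)) u
          : ℝ) := by
  set D := trivialMeasure (Matrix.specialUnitaryGroup (Fin n) ℂ) d L with hD
  haveI : IsProbabilityMeasure D := by rw [hD]; unfold trivialMeasure; infer_instance
  set P : ℝ := (Fintype.card (Plaquette d L) : ℝ) with hPdef
  have hm : AEMeasurable (fun U => -ambWilsonAction (coeConfig U)) D :=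
    (integrable_trivialMeasure_of_continuous
      (continuous_comp_coeConfig contDiff_ambWilsonAction).neg).aemeasurable
  have hb : ∀ᵐ U ∂D, |(-ambWilsonAction (coeConfig U)) - (-(n * P))| ≤ n * P :=
    ae_of_all _ fun U => by
      rw [show -ambWilsonAction (coeConfig U) - -((n : ℝ) * P) = -(ambWilsonAction (coeConfig U) - n * P)
        by ring, abs_neg, hPdef]
      exact abs_ambWilsonAction_sub_le U
  obtain ⟨T, hT, hsum⟩ :=
    exists_zeros_sum_divisor_ge_centred (μ := D) hm hb hR hρ hfree
  refine ⟨T, hT, ?_⟩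
  have hvar : variance (fun U => -ambWilsonAction (coeConfig U)) D =
      (∫ g, ((g : Matrix (Fin n) (Fin n) ℂ)).trace.re ^ 2
        ∂(haarProbability (Matrix.specialUnitaryGroup (Fin n) ℂ))) * P := by
    rw [variance_fun_neg, hD, wilson_variance_eq hL hn]
  rw [hvar, abs_of_nonneg (by positivity)] at hsum
  calc ρ ^ 2 * ((∫ g, ((g : Matrix (Fin n) (Fin n) ℂ)).trace.re ^ 2
          ∂(haarProbability (Matrix.specialUnitaryGroup (Fin n) ℂ))) - 4 * n / R) * P
      = ρ ^ 2 * ((∫ g, ((g : Matrix (Fin n) (Fin n) ℂ)).trace.re ^ 2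
          ∂(haarProbability (Matrix.specialUnitaryGroup (Fin n) ℂ))) * P - 4 * (n * P) / R) := by
        ring
    _ ≤ _ := hsum

/-- **An EXPLICIT volume-uniform zero-free radius: `Z_L(s) ≠ 0` for `|s| < 1/θ₁(d, n, B)`**, every `L`
(`θ₁` = the growth constant of the tree's PROVED THEOREM A, `GradedSeries.theta1`; THEOREM F′). [ours] -/
theorem wilson_actionZ_zeroFree_theta1 (hn : n ≠ 0) (B : SuBasis n) (L : ℕ) [NeZero L] (s : ℂ)
    (hs : ‖s‖ < (GradedSeries.theta1 d n B)⁻¹) :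
    complexMGF (fun U => -ambWilsonAction (coeConfig U))
      (trivialMeasure (Matrix.specialUnitaryGroup (Fin n) ℂ) d L) s ≠ 0 := fun hz =>
  absurd (IsLuscherSeries.radius_le_norm_of_actionZ_eq_zero (isLuscherSeries_wilsonSk B)
      contDiff_ambWilsonAction (contDiff_wilsonSk B)
      (inv_pos.2 (zero_lt_one.trans_le (GradedSeries.one_le_theta1 d n B)))
      (fun k U e a => by
        rw [inv_inv]; exact GradedSeries.abs_linkDeriv_wilsonSk_le B hn k U e a) hz)
    (not_le.mpr hs)

/-- **EXPLICIT FORM: at least `θ₁(d,n,B)⁻²·(m₂(n) − 4n/R)·#plaquettes` Fisher zeros (with multiplicity)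
with `1/θ₁ ≤ |u| < R`, every `L ≥ 2`.** [ours] -/
theorem wilson_fisherZeros_extensive_explicit (hn : 2 ≤ n) (B : SuBasis n) (L : ℕ) [NeZero L]
    (hL : 2 ≤ L) (R : ℝ) (hR : 0 < R) :
    ∃ T : Finset ℂ, (∀ u ∈ T,
        complexMGF (fun U => -ambWilsonAction (coeConfig U))
            (trivialMeasure (Matrix.specialUnitaryGroup (Fin n) ℂ) d L) u = 0 ∧
          (GradedSeries.theta1 d n B)⁻¹ ≤ ‖u‖ ∧ ‖u‖ < R ∧
          1 ≤ divisor (complexMGF (fun U => -ambWilsonAction (coeConfig U))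
            (trivialMeasure (Matrix.specialUnitaryGroup (Fin n) ℂ) d L)) (closedBall (0 : ℂ) (2 * R)) u) ∧
      (GradedSeries.theta1 d n B)⁻¹ ^ 2 * ((∫ g, ((g : Matrix (Fin n) (Fin n) ℂ)).trace.re ^ 2
          ∂(haarProbability (Matrix.specialUnitaryGroup (Fin n) ℂ))) - 4 * n / R) *
          Fintype.card (Plaquette d L) ≤
        ∑ u ∈ T, (divisor (complexMGF (fun U => -ambWilsonAction (coeConfig U))
            (trivialMeasure (Matrix.specialUnitaryGroup (Fin n) ℂ) d L)) (closedBall (0 : ℂ) (2 * R)) u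
          : ℝ) :=
  wilson_fisherZeros_extensive_of_zeroFree hn
    (inv_pos.2 (zero_lt_one.trans_le (GradedSeries.one_le_theta1 d n B))) L hL
    (fun s hs => wilson_actionZ_zeroFree_theta1 (by omega) B L s hs) R hR

/-- **THE FISHER ZEROS OF `Z_L` IN A FIXED DISC ARE EXTENSIVE.**  For `n ≥ 2` (any `d`) and a basis
`B` of `𝔰𝔲(n)` there is `ρ > 0` (the volume-uniform zero-free radius of THEOREM A + F′) such that for
every `L ≥ 2` and every `R > 0` the `SU(n)` Wilson partition function `Z_L` has a finite set `T` of
zeros with `ρ ≤ |u| < R`, each of multiplicity `divisor Z_L (closedBall 0 (2R)) u ≥ 1`, and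
`ρ²·(m₂(n) − 4n/R)·#plaq ≤ ∑_{u ∈ T} divisor Z_L (closedBall 0 (2R)) u`. [ours] -/
theorem wilson_fisherZeros_extensive (hn : 2 ≤ n) (B : SuBasis n) :
    ∃ ρ : ℝ, 0 < ρ ∧ ∀ (L : ℕ) [NeZero L], 2 ≤ L → ∀ R : ℝ, 0 < R →
      ∃ T : Finset ℂ, (∀ u ∈ T,
          complexMGF (fun U => -ambWilsonAction (coeConfig U))
              (trivialMeasure (Matrix.specialUnitaryGroup (Fin n) ℂ) d L) u = 0 ∧
            ρ ≤ ‖u‖ ∧ ‖u‖ < R ∧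
            1 ≤ divisor (complexMGF (fun U => -ambWilsonAction (coeConfig U))
              (trivialMeasure (Matrix.specialUnitaryGroup (Fin n) ℂ) d L)) (closedBall (0 : ℂ) (2 * R)) u) ∧
        ρ ^ 2 * ((∫ g, ((g : Matrix (Fin n) (Fin n) ℂ)).trace.re ^ 2
            ∂(haarProbability (Matrix.specialUnitaryGroup (Fin n) ℂ))) - 4 * n / R) *
            Fintype.card (Plaquette d L) ≤
          ∑ u ∈ T, (divisor (complexMGF (fun U => -ambWilsonAction (coeConfig U))
              (trivialMeasure (Matrix.specialUnitaryGroup (Fin n) ℂ) d L)) (closedBall (0 : ℂ) (2 * R)) u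
            : ℝ) := by
  obtain ⟨ρ, hρ, hfree⟩ := wilson_actionZ_zeroFree_uniform d n B
  exact ⟨ρ, hρ, fun L _ hL R hR =>
    wilson_fisherZeros_extensive_of_zeroFree hn hρ L hL (fun s hs => hfree L s hs) R hR⟩

/-- **`SU(2)`: at least `ρ²·(1 − 8/R)·#plaq` Fisher zeros (with multiplicity) in `|s| < R`, every
`L ≥ 2`.** [ours] -/
theorem wilson_su2_fisherZeros_extensive (B : SuBasis 2) :
    ∃ ρ : ℝ, 0 < ρ ∧ ∀ (L : ℕ) [NeZero L], 2 ≤ L → ∀ R : ℝ, 0 < R →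
      ∃ T : Finset ℂ, (∀ u ∈ T,
          complexMGF (fun U => -ambWilsonAction (coeConfig U))
              (trivialMeasure (Matrix.specialUnitaryGroup (Fin 2) ℂ) d L) u = 0 ∧
            ρ ≤ ‖u‖ ∧ ‖u‖ < R ∧
            1 ≤ divisor (complexMGF (fun U => -ambWilsonAction (coeConfig U))
              (trivialMeasure (Matrix.specialUnitaryGroup (Fin 2) ℂ) d L)) (closedBall (0 : ℂ) (2 * R)) u) ∧
        ρ ^ 2 * (1 - 8 / R) * Fintype.card (Plaquette d L) ≤
          ∑ u ∈ T, (divisor (complexMGF (fun U => -ambWilsonAction (coeConfig U))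
              (trivialMeasure (Matrix.specialUnitaryGroup (Fin 2) ℂ) d L)) (closedBall (0 : ℂ) (2 * R)) u
            : ℝ) := by
  obtain ⟨ρ, hρ, h⟩ := wilson_fisherZeros_extensive (d := d) (n := 2) le_rfl B
  refine ⟨ρ, hρ, fun L _ hL R hR => ?_⟩
  obtain ⟨T, hT, hsum⟩ := h L hL R hR
  refine ⟨T, hT, ?_⟩
  rw [haarSqReTrace_su2] at hsum
  have : (1 : ℝ) - 4 * (2 : ℕ) / R = 1 - 8 / R := by norm_num
  rwa [this] at hsum


/-- **`SU(n)`, `n ≥ 3` (`m₂ = ½`): at least `ρ²·(1/2 − 4n/R)·#plaq` Fisher zeros (with multiplicity)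
in `|s| < R`, every `L ≥ 2`** (e.g. `≥ ρ²·#plaq/4` in `|s| < 16n`). [ours] -/
theorem wilson_sun_fisherZeros_extensive (hn : 3 ≤ n) (B : SuBasis n) :
    ∃ ρ : ℝ, 0 < ρ ∧ ∀ (L : ℕ) [NeZero L], 2 ≤ L → ∀ R : ℝ, 0 < R →
      ∃ T : Finset ℂ, (∀ u ∈ T,
          complexMGF (fun U => -ambWilsonAction (coeConfig U))
              (trivialMeasure (Matrix.specialUnitaryGroup (Fin n) ℂ) d L) u = 0 ∧
            ρ ≤ ‖u‖ ∧ ‖u‖ < R ∧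
            1 ≤ divisor (complexMGF (fun U => -ambWilsonAction (coeConfig U))
              (trivialMeasure (Matrix.specialUnitaryGroup (Fin n) ℂ) d L)) (closedBall (0 : ℂ) (2 * R)) u) ∧
        ρ ^ 2 * (1 / 2 - 4 * n / R) * Fintype.card (Plaquette d L) ≤
          ∑ u ∈ T, (divisor (complexMGF (fun U => -ambWilsonAction (coeConfig U))
              (trivialMeasure (Matrix.specialUnitaryGroup (Fin n) ℂ) d L)) (closedBall (0 : ℂ) (2 * R)) u
            : ℝ) := by
  obtain ⟨ρ, hρ, h⟩ := wilson_fisherZeros_extensive (d := d) (n := n) (by omega) B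
  refine ⟨ρ, hρ, fun L _ hL R hR => ?_⟩
  obtain ⟨T, hT, hsum⟩ := h L hL R hR
  refine ⟨T, hT, ?_⟩
  rwa [haarSqReTrace_eq_half hn] at hsum

end Summit.Ventures.LatticeQCDFlow.TrivializingMaps

end
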